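import Summits.QuantumFields.GaugeBoot.Certificates.SparseReduced
import HarnessLib

/-!
# Gauge-boot: symmetry of lean3's block-entry access (kit lemma for interface-A torus layers)

Cell `pub-gaugeboot` (HOME `run/shared/lean/pub/pub-gaugeboot/`), seat lean1 (torus layers binding lean3's `Certificates.<Fam>.redBlock`
directly — interface A of record, lead A129 / lean3 INBOX l.464, l.496).

HONEST FRAMING (page 1 of every file of this cell): certified bounds on lattice expectations at STATED coupling,
gauge group, dimension and torus size; NOT a mass gap, NOT a continuum limit, NOT a string tension, NOT large `N`.
The venture is explicitly NOT Yang–Mills-summit-bearing (barriers `FixedCouplingUltralocality`,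
`PerturbativeInvisibility`).

lean3's certificate families store a reduced block's entries for `i ≤ j` and read them symmetrically
(`Certificates.Sparse.ent EB k i j = if i ≤ j then entU EB k i j else entU EB k j i`).  The torus layers' congruence step
(`<Fam>RedKit.entryMatrix_posSemidef`) checks the reduction identity on `i ≤ j` only and needs this symmetry as a lemma.
-/

namespace Summit.QuantumFields.GaugeBoot

namespace RedEnc

/-- **lean3's symmetric block-entry access is symmetric**: `Sparse.ent EB k i j = Sparse.ent EB k j i`. -/
theorem sparse_ent_comm (EB : List (List (List (List (ℕ × ℤ))))) (k i j : ℕ) :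
    Certificates.Sparse.ent EB k i j = Certificates.Sparse.ent EB k j i := by
  unfold Certificates.Sparse.ent
  split_ifs with h1 h2 h2
  · obtain rfl : i = j := Nat.le_antisymm h1 h2; rfl
  · rfl
  · rfl
  · exfalso; omega

end RedEnc

end Summit.QuantumFields.GaugeBoot
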